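import Literature.AnabelianGeometry.SemiGraphs.ArithThm54CapstonesCharCoresLevelTopology
import Literature.AnabelianGeometry.SemiGraphs.ArithTowerCharacteristicLevels
import HarnessLib

/-!
# [SemiAnbd] Thm 5.4 (i) ∧ (ii) AT `π₁^temp(𝒢) ⋊^out Π_A` OF THE CHARACTERISTIC GALOIS TOWER — EVERY
# producer-class input DISCHARGED: the statement modulo DESIGN data, the print frame and (AI4″) only

Mochizuki, *Semi-graphs of anabelioids*, Publ. RIMS **42** (2006) 221–322, §5 Thm 5.4 (i)(ii), manuscript p. 66
(l. 50: "the proofs are entirely parallel to those of Theorem 3.7, Corollary 3.9"); Rmk 5.3.1 p. 65; Def 5.1 (i)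
p. 62; Prop 5.2 (i) p. 63; Prop 3.6 p. 38; Ex 3.10 p. 44 [cite: MochizukiSemiAnbd2006, Thm 5.4 (i), p. 66].

PROOF-ONLY file (abc-iut cell, layer L3, producer row T54-B = `plan/GAP-LEDGER.md` G-w4d053-1; seat
abc-iut-w4-d029 gen 4, «T54·CAPSTONE-v3@char-tower», LAST STEP).  No definition, no new named fact, no
producer restated.

* `GaloisLevelData.ofCharCores_ker_piLevelAut_eq_charOpenCore` — **the characteristic-levels identification
  `hker` at abc-iut-w4-d048's tower `GaloisLevelData.ofCharCores h36 v₀ hVt hEt`**: for every `k`, the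
  finite-level kernel `ker π_k` of the tower's tempered group IS its characteristic open core of index `k` —
  abc-iut-L3-t9's `ker_piLevelAut_ofGaloisSeq_eq_charOpenCore` (ArithTowerCharacteristicLevels.lean p434994:
  `ker π_k = charOpenCore (D.temperedPi) d` as soon as every point of `F(A k)` has `Aut F`-stabiliser
  `charOpenCore (Aut F) d`) fed with this seat's `stabilizer_eq_charOpenCore_of_charCoreObj`
  (GaloisLevelDataOfCharCoresFaithful.lean p437588) at `d := k`.
* `arithMaximalCompactStatement_outerAction_piPresentation_charCores_of_designData` — this seat's
  `…_charCores_of_producers_levelTopology` (ArithThm54CapstonesCharCoresLevelTopology.lean p438015; over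
  abc-iut-w4-d089's level-topology pin p437233, abc-iut-w6-d070's `arithLevelTopology`, abc-iut-w4-d053's hP /
  hnobpNCpt transports, abc-iut-L3-t9's E1 junction, abc-iut-w4-d040's hR/hVE, abc-iut-w4-d048's characteristic
  tower) with `d := id` and `hker := ofCharCores_ker_piLevelAut_eq_charOpenCore`: **[SemiAnbd] Thm 5.4 (i) ∧ (ii)
  for the decomposition data produced inside `E := π₁^temp(𝒢) ⋊^out_{ρ'} Π_A` from the chart of the
  CHARACTERISTIC tower, with NO producer-class binder left.**

HONEST RESIDUAL (explicit binders) — all DESIGN / PRINT-FRAME / NAMED-ROW inputs, none a theorem owed by this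
row: the Prop 3.6 (iv)-at-`ρ_𝔾(a)` / Def 5.1 (i)(c) DESIGN data of the outer action `hV`, `hE`, `hopen`, `hBR`
(abc-iut-w4-d082's currency; jointly inhabited at the trivial action, abc-iut-w6-d099 p433299); the ONE
continuity binder `hK1′` of the level-B topology (Def 5.1 (i)(c) congruence-continuity; row «T54·hK1′»,
abc-iut-w6-d117); the topology pin `hinst` (`rfl` at the call site); Thm 5.4's printed frame hypothesis
`noSwitchBase` and its OWN hypotheses `hest` (total arithmetic estrangement; FALSE at split actions —
abc-iut-w6-d072 p433406 — so only non-split outer actions are contentful) and `hbot`; (AI4″)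
`stabBranchPairAug` (row of abc-iut-w4-d059); the §5 frame `[CompactSpace Π_A] [TotallyDisconnectedSpace Π_A]`;
Def 5.1 (i) coherence `[Finite Vertex] [Finite Branch] [Finite Edge]`, `hVt`, `hEt`; base vertex `v₀`; the
Thm 3.7 hypotheses `h37` and `hG`.  Nothing beyond composition is proved here; typed ≠ proved for the residual
inputs; this is Thm 5.4 for OUR tower decomposition; no side taken on [IUTchIII] Cor. 3.12.
-/

namespace Literature.AnabelianGeometry.SemiGraphs

namespace ProfiniteSemiGraph

open CategoryTheory CategoryTheory.PreGaloisCategory Topology Filter Literature.AnabelianGeometry.Anabelioids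
open Literature.AnabelianGeometry.EtaleTheta
open Literature.AnabelianGeometry.AbsoluteAnabelian (IsTopologicallyFinitelyGenerated)
open scoped Pointwise FintypeCatDiscrete

universe u

variable {𝒢 : ProfiniteSemiGraph.{u}}

/-- **`hker` at the characteristic tower**: the `k`-th finite-level kernel of the tempered group of
abc-iut-w4-d048's tower `GaloisLevelData.ofCharCores h36 v₀ hVt hEt` is its characteristic open core of index
`k` (abc-iut-L3-t9's `ker_piLevelAut_ofGaloisSeq_eq_charOpenCore` at `d := k`, point stabilisers by
`stabilizer_eq_charOpenCore_of_charCoreObj`). [cite: MochizukiSemiAnbd2006, Prop 5.2 (i), p. 63] -/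
theorem GaloisLevelData.ofCharCores_ker_piLevelAut_eq_charOpenCore [Finite 𝒢.graph.Vertex] [Finite 𝒢.graph.Branch]
    (h36 : 𝒢.Prop36Hypotheses) (v₀ : 𝒢.graph.Vertex)
    (hVt : ∀ v : 𝒢.graph.Vertex, IsTopologicallyFinitelyGenerated (𝒢.Gv v))
    (hEt : ∀ e : 𝒢.graph.Edge, IsTopologicallyFinitelyGenerated (𝒢.Ge e)) (k : ℕ) :
    ((GaloisLevelData.ofCharCores h36 v₀ hVt hEt).piLevelAut h36.isCountable
        (ofCharCores_sameComponent h36 v₀ hVt hEt) k).ker =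
      charOpenCore ((GaloisLevelData.ofCharCores h36 v₀ hVt hEt).temperedPi h36.isCountable) k :=
  𝒢.ker_piLevelAut_ofGaloisSeq_eq_charOpenCore h36 v₀ (charCoreObj h36 v₀ hVt hEt) (isGalois_charCoreObj h36 v₀ hVt hEt)
    (seqHom h36.isConnected v₀ (fun k => charOpenCore (Aut (𝒢.fiberAt v₀)) k)
      (isOpen_charOpenCore_autFiberAt h36 v₀ hVt hEt) (finiteIndex_charOpenCore_autFiberAt h36 v₀ hVt hEt)
      (fun _ _ h => charOpenCore_anti h))
    (ofCharCores_exists_level_splits_component h36 v₀ hVt hEt) k k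
    (stabilizer_eq_charOpenCore_of_charCoreObj h36 v₀ hVt hEt k)

/-- **[SemiAnbd] Thm 5.4 (i) ∧ (ii) at `π₁^temp(𝒢) ⋊^out Π_A` for the chart of the CHARACTERISTIC Galois tower,
every producer-class input discharged** — residual = design data `hV`/`hE`/`hopen`/`hBR`, the continuity binder
`hK1′`, the topology pin `hinst`, Thm 5.4's frame `noSwitchBase` and hypotheses `hest`/`hbot`, (AI4″)
`stabBranchPairAug`, the §5 frame and Def 5.1 (i) coherence (owners in the module docstring).
[cite: MochizukiSemiAnbd2006, Thm 5.4 (i), p. 66] -/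
theorem arithMaximalCompactStatement_outerAction_piPresentation_charCores_of_designData
    (h37 : 𝒢.Thm37Hypotheses) (hG : 𝒢.graph.IsGraph) [Finite 𝒢.graph.Vertex] [Finite 𝒢.graph.Branch]
    [Finite 𝒢.graph.Edge] (v₀ : 𝒢.graph.Vertex)
    -- coherence (Def 5.1 (i)): topologically finitely generated constituents — the input of the characteristic tower
    (hVt : ∀ v : 𝒢.graph.Vertex, IsTopologicallyFinitelyGenerated (𝒢.Gv v))
    (hEt : ∀ e : 𝒢.graph.Edge, IsTopologicallyFinitelyGenerated (𝒢.Ge e))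
    {PA : Type u} [Group PA] [TopologicalSpace PA] [IsTopologicalGroup PA] [CompactSpace PA]
    [TotallyDisconnectedSpace PA]
    (ρ' : PA →* TopOut ((GaloisLevelData.ofCharCores h37.toProp36Hypotheses v₀ hVt hEt).chart h37.toProp36Hypotheses.isCountable (ofCharCores_exists_level_splits_component h37.toProp36Hypotheses v₀ hVt hEt) h37.toProp36Hypotheses.isConnected (ofCharCores_splits_self h37.toProp36Hypotheses v₀ hVt hEt) (ofCharCores_isFinite h37.toProp36Hypotheses v₀ hVt hEt) (ofCharCores_hasNonemptyFibres h37.toProp36Hypotheses v₀ hVt hEt)).G) (baseAct : PA →* Aut 𝒢.graph)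
    [inst : TopologicalSpace (outerSemidirectProduct ρ')]
    (T : ∀ w : 𝒢.graph.Vertex, (GaloisLevelData.ofCharCores h37.toProp36Hypotheses v₀ hVt hEt).PointSeq h37.toProp36Hypotheses.isCountable w) (R : SemiGraph.RefBranches 𝒢.graph)
    (Rc : ChartRepresentatives ((GaloisLevelData.ofCharCores h37.toProp36Hypotheses v₀ hVt hEt).chart h37.toProp36Hypotheses.isCountable (ofCharCores_exists_level_splits_component h37.toProp36Hypotheses v₀ hVt hEt) h37.toProp36Hypotheses.isConnected (ofCharCores_splits_self h37.toProp36Hypotheses v₀ hVt hEt) (ofCharCores_isFinite h37.toProp36Hypotheses v₀ hVt hEt) (ofCharCores_hasNonemptyFibres h37.toProp36Hypotheses v₀ hVt hEt)))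
    -- Prop 3.6 (iv) at `ρ_𝔾(a)` / Def 5.1 (i)(c): the DESIGN data of the outer model (abc-iut-w4-d082's currency)
    (hV : ∀ (a : PA) (v : 𝒢.graph.Vertex) (H : Subgroup ((GaloisLevelData.ofCharCores h37.toProp36Hypotheses v₀ hVt hEt).chart h37.toProp36Hypotheses.isCountable (ofCharCores_exists_level_splits_component h37.toProp36Hypotheses v₀ hVt hEt) h37.toProp36Hypotheses.isConnected (ofCharCores_splits_self h37.toProp36Hypotheses v₀ hVt hEt) (ofCharCores_isFinite h37.toProp36Hypotheses v₀ hVt hEt) (ofCharCores_hasNonemptyFibres h37.toProp36Hypotheses v₀ hVt hEt)).G), H ∈ verticialSubgroups ((GaloisLevelData.ofCharCores h37.toProp36Hypotheses v₀ hVt hEt).chart h37.toProp36Hypotheses.isCountable (ofCharCores_exists_level_splits_component h37.toProp36Hypotheses v₀ hVt hEt) h37.toProp36Hypotheses.isConnected (ofCharCores_splits_self h37.toProp36Hypotheses v₀ hVt hEt) (ofCharCores_isFinite h37.toProp36Hypotheses v₀ hVt hEt) (ofCharCores_hasNonemptyFibres h37.toProp36Hypotheses v₀ hVt hEt)) v 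→
      ∃ φ : contMulAut ((GaloisLevelData.ofCharCores h37.toProp36Hypotheses v₀ hVt hEt).chart h37.toProp36Hypotheses.isCountable (ofCharCores_exists_level_splits_component h37.toProp36Hypotheses v₀ hVt hEt) h37.toProp36Hypotheses.isConnected (ofCharCores_splits_self h37.toProp36Hypotheses v₀ hVt hEt) (ofCharCores_isFinite h37.toProp36Hypotheses v₀ hVt hEt) (ofCharCores_hasNonemptyFibres h37.toProp36Hypotheses v₀ hVt hEt)).G, TopOut.mk _ φ = ρ' a ∧
        H.map (φ : MulAut ((GaloisLevelData.ofCharCores h37.toProp36Hypotheses v₀ hVt hEt).chart h37.toProp36Hypotheses.isCountable (ofCharCores_exists_level_splits_component h37.toProp36Hypotheses v₀ hVt hEt) h37.toProp36Hypotheses.isConnected (ofCharCores_splits_self h37.toProp36Hypotheses v₀ hVt hEt) (ofCharCores_isFinite h37.toProp36Hypotheses v₀ hVt hEt) (ofCharCores_hasNonemptyFibres h37.toProp36Hypotheses v₀ hVt hEt)).G).toMonoidHom ∈ verticialSubgroups ((GaloisLevelData.ofCharCores h37.toProp36Hypotheses v₀ hVt hEt).chart h37.toProp36Hypotheses.isCountable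 (ofCharCores_exists_level_splits_component h37.toProp36Hypotheses v₀ hVt hEt) h37.toProp36Hypotheses.isConnected (ofCharCores_splits_self h37.toProp36Hypotheses v₀ hVt hEt) (ofCharCores_isFinite h37.toProp36Hypotheses v₀ hVt hEt) (ofCharCores_hasNonemptyFibres h37.toProp36Hypotheses v₀ hVt hEt)) ((baseAct a).hom.vertexMap v))
    (hE : ∀ (a : PA) (e : 𝒢.graph.Edge) (K : Subgroup ((GaloisLevelData.ofCharCores h37.toProp36Hypotheses v₀ hVt hEt).chart h37.toProp36Hypotheses.isCountable (ofCharCores_exists_level_splits_component h37.toProp36Hypotheses v₀ hVt hEt) h37.toProp36Hypotheses.isConnected (ofCharCores_splits_self h37.toProp36Hypotheses v₀ hVt hEt) (ofCharCores_isFinite h37.toProp36Hypotheses v₀ hVt hEt) (ofCharCores_hasNonemptyFibres h37.toProp36Hypotheses v₀ hVt hEt)).G), K ∈ edgeLikeSubgroups ((GaloisLevelData.ofCharCores h37.toProp36Hypotheses v₀ hVt hEt).chart h37.toProp36Hypotheses.isCountable (ofCharCores_exists_level_splits_component h37.toProp36Hypotheses v₀ hVt hEt) h37.toProp36Hypotheses.isConnected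 (ofCharCores_splits_self h37.toProp36Hypotheses v₀ hVt hEt) (ofCharCores_isFinite h37.toProp36Hypotheses v₀ hVt hEt) (ofCharCores_hasNonemptyFibres h37.toProp36Hypotheses v₀ hVt hEt)) e →
      ∃ φ : contMulAut ((GaloisLevelData.ofCharCores h37.toProp36Hypotheses v₀ hVt hEt).chart h37.toProp36Hypotheses.isCountable (ofCharCores_exists_level_splits_component h37.toProp36Hypotheses v₀ hVt hEt) h37.toProp36Hypotheses.isConnected (ofCharCores_splits_self h37.toProp36Hypotheses v₀ hVt hEt) (ofCharCores_isFinite h37.toProp36Hypotheses v₀ hVt hEt) (ofCharCores_hasNonemptyFibres h37.toProp36Hypotheses v₀ hVt hEt)).G, TopOut.mk _ φ = ρ' a ∧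
        K.map (φ : MulAut ((GaloisLevelData.ofCharCores h37.toProp36Hypotheses v₀ hVt hEt).chart h37.toProp36Hypotheses.isCountable (ofCharCores_exists_level_splits_component h37.toProp36Hypotheses v₀ hVt hEt) h37.toProp36Hypotheses.isConnected (ofCharCores_splits_self h37.toProp36Hypotheses v₀ hVt hEt) (ofCharCores_isFinite h37.toProp36Hypotheses v₀ hVt hEt) (ofCharCores_hasNonemptyFibres h37.toProp36Hypotheses v₀ hVt hEt)).G).toMonoidHom ∈ edgeLikeSubgroups ((GaloisLevelData.ofCharCores h37.toProp36Hypotheses v₀ hVt hEt).chart h37.toProp36Hypotheses.isCountable (ofCharCores_exists_level_splits_component h37.toProp36Hypotheses v₀ hVt hEt) h37.toProp36Hypotheses.isConnected (ofCharCores_splits_self h37.toProp36Hypotheses v₀ hVt hEt) (ofCharCores_isFinite h37.toProp36Hypotheses v₀ hVt hEt) (ofCharCores_hasNonemptyFibres h37.toProp36Hypotheses v₀ hVt hEt)) ((baseAct a).hom.edgeMap e))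
    (hopen : ∃ U : Subgroup PA, IsOpen (U : Set PA) ∧ ∀ a ∈ U,
      (∀ v, (baseAct a).hom.vertexMap v = v) ∧ (∀ e, (baseAct a).hom.edgeMap e = e) ∧
        ∀ b, (baseAct a).hom.branchMap b = b)
    (hBR : ∀ (a : PA) (b : 𝒢.graph.Branch) (v : 𝒢.graph.Vertex) (hb : 𝒢.graph.abuts b = some v)
      (φ : 𝒢.Gv v →ₜ* ((GaloisLevelData.ofCharCores h37.toProp36Hypotheses v₀ hVt hEt).chart h37.toProp36Hypotheses.isCountable (ofCharCores_exists_level_splits_component h37.toProp36Hypotheses v₀ hVt hEt) h37.toProp36Hypotheses.isConnected (ofCharCores_splits_self h37.toProp36Hypotheses v₀ hVt hEt) (ofCharCores_isFinite h37.toProp36Hypotheses v₀ hVt hEt) (ofCharCores_hasNonemptyFibres h37.toProp36Hypotheses v₀ hVt hEt)).G), IsVerticialHom ((GaloisLevelData.ofCharCores h37.toProp36Hypotheses v₀ hVt hEt).chart h37.toProp36Hypotheses.isCountable (ofCharCores_exists_level_splits_component h37.toProp36Hypotheses v₀ hVt hEt) h37.toProp36Hypotheses.isConnected (ofCharCores_splits_self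 h37.toProp36Hypotheses v₀ hVt hEt) (ofCharCores_isFinite h37.toProp36Hypotheses v₀ hVt hEt) (ofCharCores_hasNonemptyFibres h37.toProp36Hypotheses v₀ hVt hEt)) v φ →
      ∃ Φ : contMulAut ((GaloisLevelData.ofCharCores h37.toProp36Hypotheses v₀ hVt hEt).chart h37.toProp36Hypotheses.isCountable (ofCharCores_exists_level_splits_component h37.toProp36Hypotheses v₀ hVt hEt) h37.toProp36Hypotheses.isConnected (ofCharCores_splits_self h37.toProp36Hypotheses v₀ hVt hEt) (ofCharCores_isFinite h37.toProp36Hypotheses v₀ hVt hEt) (ofCharCores_hasNonemptyFibres h37.toProp36Hypotheses v₀ hVt hEt)).G, TopOut.mk _ Φ = ρ' a ∧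
        ∃ φ' : 𝒢.Gv ((baseAct a).hom.vertexMap v) →ₜ* ((GaloisLevelData.ofCharCores h37.toProp36Hypotheses v₀ hVt hEt).chart h37.toProp36Hypotheses.isCountable (ofCharCores_exists_level_splits_component h37.toProp36Hypotheses v₀ hVt hEt) h37.toProp36Hypotheses.isConnected (ofCharCores_splits_self h37.toProp36Hypotheses v₀ hVt hEt) (ofCharCores_isFinite h37.toProp36Hypotheses v₀ hVt hEt) (ofCharCores_hasNonemptyFibres h37.toProp36Hypotheses v₀ hVt hEt)).G,
          IsVerticialHom ((GaloisLevelData.ofCharCores h37.toProp36Hypotheses v₀ hVt hEt).chart h37.toProp36Hypotheses.isCountable (ofCharCores_exists_level_splits_component h37.toProp36Hypotheses v₀ hVt hEt) h37.toProp36Hypotheses.isConnected (ofCharCores_splits_self h37.toProp36Hypotheses v₀ hVt hEt) (ofCharCores_isFinite h37.toProp36Hypotheses v₀ hVt hEt) (ofCharCores_hasNonemptyFibres h37.toProp36Hypotheses v₀ hVt hEt)) ((baseAct a).hom.vertexMap v) φ' ∧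
          ∃ x' : ((GaloisLevelData.ofCharCores h37.toProp36Hypotheses v₀ hVt hEt).chart h37.toProp36Hypotheses.isCountable (ofCharCores_exists_level_splits_component h37.toProp36Hypotheses v₀ hVt hEt) h37.toProp36Hypotheses.isConnected (ofCharCores_splits_self h37.toProp36Hypotheses v₀ hVt hEt) (ofCharCores_isFinite h37.toProp36Hypotheses v₀ hVt hEt) (ofCharCores_hasNonemptyFibres h37.toProp36Hypotheses v₀ hVt hEt)).G,
            Subgroup.map (Φ : MulAut ((GaloisLevelData.ofCharCores h37.toProp36Hypotheses v₀ hVt hEt).chart h37.toProp36Hypotheses.isCountable (ofCharCores_exists_level_splits_component h37.toProp36Hypotheses v₀ hVt hEt) h37.toProp36Hypotheses.isConnected (ofCharCores_splits_self h37.toProp36Hypotheses v₀ hVt hEt) (ofCharCores_isFinite h37.toProp36Hypotheses v₀ hVt hEt) (ofCharCores_hasNonemptyFibres h37.toProp36Hypotheses v₀ hVt hEt)).G).toMonoidHom φ.toMonoidHom.range =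
              Subgroup.map (MulAut.conj x').toMonoidHom φ'.toMonoidHom.range ∧
            Subgroup.map (Φ : MulAut ((GaloisLevelData.ofCharCores h37.toProp36Hypotheses v₀ hVt hEt).chart h37.toProp36Hypotheses.isCountable (ofCharCores_exists_level_splits_component h37.toProp36Hypotheses v₀ hVt hEt) h37.toProp36Hypotheses.isConnected (ofCharCores_splits_self h37.toProp36Hypotheses v₀ hVt hEt) (ofCharCores_isFinite h37.toProp36Hypotheses v₀ hVt hEt) (ofCharCores_hasNonemptyFibres h37.toProp36Hypotheses v₀ hVt hEt)).G).toMonoidHom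
                (Subgroup.map φ.toMonoidHom (𝒢.branchSubgroup b v hb)) =
              Subgroup.map (MulAut.conj x').toMonoidHom
                (Subgroup.map φ'.toMonoidHom
                  (𝒢.branchSubgroup ((baseAct a).hom.branchMap b) ((baseAct a).hom.vertexMap v)
                    ((baseAct a).hom.abuts_branchMap b v hb))))
    (w₀ : 𝒢.graph.Vertex)
    -- the ONE continuity binder of the level-B topology (Def 5.1 (i)(c) congruence-continuity; abc-iut-w6-d117
    -- «T54·hK1′»): the images in `Π_A` of abc-iut-L3-d4's arithmetic level kernels are open
    (hK1' : ∀ n, IsOpen (((((GaloisLevelData.ofCharCores h37.toProp36Hypotheses v₀ hVt hEt).piPresentation h37.toProp36Hypotheses.isCountable T R).levelKer (isArithCompatible_piPresentation_outerAction_of_branchPair_chart_of_finite (GaloisLevelData.ofCharCores h37.toProp36Hypotheses v₀ hVt hEt) h37.toProp36Hypotheses.isCountable (ofCharCores_exists_level_splits_component h37.toProp36Hypotheses v₀ hVt hEt) h37.toProp36Hypotheses.isConnected (ofCharCores_splits_self h37.toProp36Hypotheses v₀ hVt hEt) (ofCharCores_isFinite h37.toProp36Hypotheses v₀ hVt hEt)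 (ofCharCores_hasNonemptyFibres h37.toProp36Hypotheses v₀ hVt hEt) T R ρ' baseAct h37 hG hV hBR)
        ((GaloisLevelData.ofCharCores h37.toProp36Hypotheses v₀ hVt hEt).projAut h37.toProp36Hypotheses.isCountable n).ker (((GaloisLevelData.ofCharCores h37.toProp36Hypotheses v₀ hVt hEt).hKst_and_hLst_of_ker_piLevelAut_eq_charOpenCore h37.toProp36Hypotheses.isCountable (ofCharCores_sameComponent h37.toProp36Hypotheses v₀ hVt hEt) T R ρ' (isArithCompatible_piPresentation_outerAction_of_branchPair_chart_of_finite (GaloisLevelData.ofCharCores h37.toProp36Hypotheses v₀ hVt hEt) h37.toProp36Hypotheses.isCountable (ofCharCores_exists_level_splits_component h37.toProp36Hypotheses v₀ hVt hEt) h37.toProp36Hypotheses.isConnected (ofCharCores_splits_self h37.toProp36Hypotheses v₀ hVt hEt) (ofCharCores_isFinite h37.toProp36Hypotheses v₀ hVt hEt) (ofCharCores_hasNonemptyFibres h37.toProp36Hypotheses v₀ hVt hEt) T R ρ' baseAct h37 hG hV hBR) (fun k : ℕ => k) (GaloisLevelData.ofCharCores_ker_piLevelAut_eq_charOpenCore h37.toProp36Hypotheses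 v₀ hVt hEt)).1 n)).map (outerSemidirectProductSnd ρ') :
      Subgroup PA) : Set PA))
    -- the topology of `E` IS abc-iut-w6-d070's tempered level topology at the chart of the tower
    (hinst : inst = @arithLevelTopology 𝒢 ((GaloisLevelData.ofCharCores h37.toProp36Hypotheses v₀ hVt hEt).chart h37.toProp36Hypotheses.isCountable (ofCharCores_exists_level_splits_component h37.toProp36Hypotheses v₀ hVt hEt) h37.toProp36Hypotheses.isConnected (ofCharCores_splits_self h37.toProp36Hypotheses v₀ hVt hEt) (ofCharCores_isFinite h37.toProp36Hypotheses v₀ hVt hEt) (ofCharCores_hasNonemptyFibres h37.toProp36Hypotheses v₀ hVt hEt)) PA _ _ _ ρ' baseAct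
        (TemperedPiChart.firstCountableTopology_G ((GaloisLevelData.ofCharCores h37.toProp36Hypotheses v₀ hVt hEt).chart h37.toProp36Hypotheses.isCountable (ofCharCores_exists_level_splits_component h37.toProp36Hypotheses v₀ hVt hEt) h37.toProp36Hypotheses.isConnected (ofCharCores_splits_self h37.toProp36Hypotheses v₀ hVt hEt) (ofCharCores_isFinite h37.toProp36Hypotheses v₀ hVt hEt) (ofCharCores_hasNonemptyFibres h37.toProp36Hypotheses v₀ hVt hEt))) h37.toProp36Hypotheses IsTempered.of_profinite ((GaloisLevelData.ofCharCores h37.toProp36Hypotheses v₀ hVt hEt).piPresentation h37.toProp36Hypotheses.isCountable T R)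
        (isArithCompatible_piPresentation_outerAction_of_branchPair_chart_of_finite (GaloisLevelData.ofCharCores h37.toProp36Hypotheses v₀ hVt hEt) h37.toProp36Hypotheses.isCountable (ofCharCores_exists_level_splits_component h37.toProp36Hypotheses v₀ hVt hEt) h37.toProp36Hypotheses.isConnected (ofCharCores_splits_self h37.toProp36Hypotheses v₀ hVt hEt) (ofCharCores_isFinite h37.toProp36Hypotheses v₀ hVt hEt) (ofCharCores_hasNonemptyFibres h37.toProp36Hypotheses v₀ hVt hEt) T R ρ' baseAct h37 hG hV hBR) w₀
        ((GaloisLevelData.ofCharCores h37.toProp36Hypotheses v₀ hVt hEt).isCompact_piPresentation_H h37.toProp36Hypotheses.isCountable T R w₀) (fun n => ((GaloisLevelData.ofCharCores h37.toProp36Hypotheses v₀ hVt hEt).projAut h37.toProp36Hypotheses.isCountable n).ker) (fun _ => MonoidHom.normal_ker _)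
        ((GaloisLevelData.ofCharCores h37.toProp36Hypotheses v₀ hVt hEt).hKst_and_hLst_of_ker_piLevelAut_eq_charOpenCore h37.toProp36Hypotheses.isCountable (ofCharCores_sameComponent h37.toProp36Hypotheses v₀ hVt hEt) T R ρ' (isArithCompatible_piPresentation_outerAction_of_branchPair_chart_of_finite (GaloisLevelData.ofCharCores h37.toProp36Hypotheses v₀ hVt hEt) h37.toProp36Hypotheses.isCountable (ofCharCores_exists_level_splits_component h37.toProp36Hypotheses v₀ hVt hEt) h37.toProp36Hypotheses.isConnected (ofCharCores_splits_self h37.toProp36Hypotheses v₀ hVt hEt) (ofCharCores_isFinite h37.toProp36Hypotheses v₀ hVt hEt) (ofCharCores_hasNonemptyFibres h37.toProp36Hypotheses v₀ hVt hEt) T R ρ' baseAct h37 hG hV hBR) (fun k : ℕ => k) (GaloisLevelData.ofCharCores_ker_piLevelAut_eq_charOpenCore h37.toProp36Hypotheses v₀ hVt hEt)).1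
        ((GaloisLevelData.ofCharCores h37.toProp36Hypotheses v₀ hVt hEt).ker_projAut_anti h37.toProp36Hypotheses.isCountable) ((GaloisLevelData.ofCharCores h37.toProp36Hypotheses v₀ hVt hEt).isOpen_ker_projAut h37.toProp36Hypotheses.isCountable) (fun _ hU => (GaloisLevelData.ofCharCores h37.toProp36Hypotheses v₀ hVt hEt).exists_ker_projAut_subset h37.toProp36Hypotheses.isCountable hU) hK1')
    (noSwitchBase : NoBranchSwitching 𝒢.graph.edgeOf
      (fun (a : PA) (b : 𝒢.graph.Branch) => (baseAct a).hom.branchMap b))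
    (stabBranchPairAug : ∀ (C : Subgroup (outerSemidirectProduct ρ')),
      IsCompact (C : Set (outerSemidirectProduct ρ')) →
      ∀ (j₀ : ℕ) (w : ∀ i : {i : ℕ // j₀ ≤ i}, (((GaloisLevelData.ofCharCores h37.toProp36Hypotheses v₀ hVt hEt).piPresentation h37.toProp36Hypotheses.isCountable T R).cosetGraph ((GaloisLevelData.ofCharCores h37.toProp36Hypotheses v₀ hVt hEt).piLevelAut h37.toProp36Hypotheses.isCountable (ofCharCores_sameComponent h37.toProp36Hypotheses v₀ hVt hEt) i.1).ker).Vertex)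
      (β β' : ∀ i : {i : ℕ // j₀ ≤ i}, (((GaloisLevelData.ofCharCores h37.toProp36Hypotheses v₀ hVt hEt).piPresentation h37.toProp36Hypotheses.isCountable T R).cosetGraph ((GaloisLevelData.ofCharCores h37.toProp36Hypotheses v₀ hVt hEt).piLevelAut h37.toProp36Hypotheses.isCountable (ofCharCores_sameComponent h37.toProp36Hypotheses v₀ hVt hEt) i.1).ker).Branch),
      (∀ i, β i ≠ β' i ∧ (((GaloisLevelData.ofCharCores h37.toProp36Hypotheses v₀ hVt hEt).piPresentation h37.toProp36Hypotheses.isCountable T R).cosetGraph ((GaloisLevelData.ofCharCores h37.toProp36Hypotheses v₀ hVt hEt).piLevelAut h37.toProp36Hypotheses.isCountable (ofCharCores_sameComponent h37.toProp36Hypotheses v₀ hVt hEt) i.1).ker).abuts (β i) = some (w i) ∧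
        (((GaloisLevelData.ofCharCores h37.toProp36Hypotheses v₀ hVt hEt).piPresentation h37.toProp36Hypotheses.isCountable T R).cosetGraph ((GaloisLevelData.ofCharCores h37.toProp36Hypotheses v₀ hVt hEt).piLevelAut h37.toProp36Hypotheses.isCountable (ofCharCores_sameComponent h37.toProp36Hypotheses v₀ hVt hEt) i.1).ker).abuts (β' i) = some (w i)) →
      (∀ ⦃i i' : {i : ℕ // j₀ ≤ i}⦄ (h : i.1 ≤ i'.1),
        (((GaloisLevelData.ofCharCores h37.toProp36Hypotheses v₀ hVt hEt).piPresentation h37.toProp36Hypotheses.isCountable T R).cosetGraphTrans ((GaloisLevelData.ofCharCores h37.toProp36Hypotheses v₀ hVt hEt).ker_piLevelAut_anti h37.toProp36Hypotheses.isCountable (ofCharCores_sameComponent h37.toProp36Hypotheses v₀ hVt hEt) h)).vertexMap (w i') = w i ∧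
        (((GaloisLevelData.ofCharCores h37.toProp36Hypotheses v₀ hVt hEt).piPresentation h37.toProp36Hypotheses.isCountable T R).cosetGraphTrans ((GaloisLevelData.ofCharCores h37.toProp36Hypotheses v₀ hVt hEt).ker_piLevelAut_anti h37.toProp36Hypotheses.isCountable (ofCharCores_sameComponent h37.toProp36Hypotheses v₀ hVt hEt) h)).branchMap (β i') = β i ∧
          (((GaloisLevelData.ofCharCores h37.toProp36Hypotheses v₀ hVt hEt).piPresentation h37.toProp36Hypotheses.isCountable T R).cosetGraphTrans ((GaloisLevelData.ofCharCores h37.toProp36Hypotheses v₀ hVt hEt).ker_piLevelAut_anti h37.toProp36Hypotheses.isCountable (ofCharCores_sameComponent h37.toProp36Hypotheses v₀ hVt hEt) h)).branchMap (β' i') = β' i) →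
      (∀ (i : {i : ℕ // j₀ ≤ i}) (g : outerSemidirectProduct ρ'), g ∈ C →
        (((GaloisLevelData.ofCharCores h37.toProp36Hypotheses v₀ hVt hEt).piPresentation h37.toProp36Hypotheses.isCountable T R).arithAct (isArithCompatible_piPresentation_outerAction_of_branchPair_chart_of_finite (GaloisLevelData.ofCharCores h37.toProp36Hypotheses v₀ hVt hEt) h37.toProp36Hypotheses.isCountable (ofCharCores_exists_level_splits_component h37.toProp36Hypotheses v₀ hVt hEt) h37.toProp36Hypotheses.isConnected (ofCharCores_splits_self h37.toProp36Hypotheses v₀ hVt hEt) (ofCharCores_isFinite h37.toProp36Hypotheses v₀ hVt hEt) (ofCharCores_hasNonemptyFibres h37.toProp36Hypotheses v₀ hVt hEt) T R ρ' baseAct h37 hG hV hBR) ((GaloisLevelData.ofCharCores h37.toProp36Hypotheses v₀ hVt hEt).piLevelAut h37.toProp36Hypotheses.isCountable (ofCharCores_sameComponent h37.toProp36Hypotheses v₀ hVt hEt) i.1).ker (((GaloisLevelData.ofCharCores h37.toProp36Hypotheses v₀ hVt hEt).hKst_and_hLst_of_ker_piLevelAut_eq_charOpenCore h37.toProp36Hypotheses.isCountable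 (ofCharCores_sameComponent h37.toProp36Hypotheses v₀ hVt hEt) T R ρ' (isArithCompatible_piPresentation_outerAction_of_branchPair_chart_of_finite (GaloisLevelData.ofCharCores h37.toProp36Hypotheses v₀ hVt hEt) h37.toProp36Hypotheses.isCountable (ofCharCores_exists_level_splits_component h37.toProp36Hypotheses v₀ hVt hEt) h37.toProp36Hypotheses.isConnected (ofCharCores_splits_self h37.toProp36Hypotheses v₀ hVt hEt) (ofCharCores_isFinite h37.toProp36Hypotheses v₀ hVt hEt) (ofCharCores_hasNonemptyFibres h37.toProp36Hypotheses v₀ hVt hEt) T R ρ' baseAct h37 hG hV hBR) (fun k : ℕ => k) (GaloisLevelData.ofCharCores_ker_piLevelAut_eq_charOpenCore h37.toProp36Hypotheses v₀ hVt hEt)).2 i.1) g).hom.vertexMap (w i) = w i ∧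
        (((GaloisLevelData.ofCharCores h37.toProp36Hypotheses v₀ hVt hEt).piPresentation h37.toProp36Hypotheses.isCountable T R).arithAct (isArithCompatible_piPresentation_outerAction_of_branchPair_chart_of_finite (GaloisLevelData.ofCharCores h37.toProp36Hypotheses v₀ hVt hEt) h37.toProp36Hypotheses.isCountable (ofCharCores_exists_level_splits_component h37.toProp36Hypotheses v₀ hVt hEt) h37.toProp36Hypotheses.isConnected (ofCharCores_splits_self h37.toProp36Hypotheses v₀ hVt hEt) (ofCharCores_isFinite h37.toProp36Hypotheses v₀ hVt hEt) (ofCharCores_hasNonemptyFibres h37.toProp36Hypotheses v₀ hVt hEt) T R ρ' baseAct h37 hG hV hBR) ((GaloisLevelData.ofCharCores h37.toProp36Hypotheses v₀ hVt hEt).piLevelAut h37.toProp36Hypotheses.isCountable (ofCharCores_sameComponent h37.toProp36Hypotheses v₀ hVt hEt) i.1).ker (((GaloisLevelData.ofCharCores h37.toProp36Hypotheses v₀ hVt hEt).hKst_and_hLst_of_ker_piLevelAut_eq_charOpenCore h37.toProp36Hypotheses.isCountable (ofCharCores_sameComponent h37.toProp36Hypotheses v₀ hVt hEt) T R ρ'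 (isArithCompatible_piPresentation_outerAction_of_branchPair_chart_of_finite (GaloisLevelData.ofCharCores h37.toProp36Hypotheses v₀ hVt hEt) h37.toProp36Hypotheses.isCountable (ofCharCores_exists_level_splits_component h37.toProp36Hypotheses v₀ hVt hEt) h37.toProp36Hypotheses.isConnected (ofCharCores_splits_self h37.toProp36Hypotheses v₀ hVt hEt) (ofCharCores_isFinite h37.toProp36Hypotheses v₀ hVt hEt) (ofCharCores_hasNonemptyFibres h37.toProp36Hypotheses v₀ hVt hEt) T R ρ' baseAct h37 hG hV hBR) (fun k : ℕ => k) (GaloisLevelData.ofCharCores_ker_piLevelAut_eq_charOpenCore h37.toProp36Hypotheses v₀ hVt hEt)).2 i.1) g).hom.branchMap (β i) = β i ∧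
          (((GaloisLevelData.ofCharCores h37.toProp36Hypotheses v₀ hVt hEt).piPresentation h37.toProp36Hypotheses.isCountable T R).arithAct (isArithCompatible_piPresentation_outerAction_of_branchPair_chart_of_finite (GaloisLevelData.ofCharCores h37.toProp36Hypotheses v₀ hVt hEt) h37.toProp36Hypotheses.isCountable (ofCharCores_exists_level_splits_component h37.toProp36Hypotheses v₀ hVt hEt) h37.toProp36Hypotheses.isConnected (ofCharCores_splits_self h37.toProp36Hypotheses v₀ hVt hEt) (ofCharCores_isFinite h37.toProp36Hypotheses v₀ hVt hEt) (ofCharCores_hasNonemptyFibres h37.toProp36Hypotheses v₀ hVt hEt) T R ρ' baseAct h37 hG hV hBR) ((GaloisLevelData.ofCharCores h37.toProp36Hypotheses v₀ hVt hEt).piLevelAut h37.toProp36Hypotheses.isCountable (ofCharCores_sameComponent h37.toProp36Hypotheses v₀ hVt hEt) i.1).ker (((GaloisLevelData.ofCharCores h37.toProp36Hypotheses v₀ hVt hEt).hKst_and_hLst_of_ker_piLevelAut_eq_charOpenCore h37.toProp36Hypotheses.isCountable (ofCharCores_sameComponent h37.toProp36Hypotheses v₀ hVt hEt) T R ρ'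 (isArithCompatible_piPresentation_outerAction_of_branchPair_chart_of_finite (GaloisLevelData.ofCharCores h37.toProp36Hypotheses v₀ hVt hEt) h37.toProp36Hypotheses.isCountable (ofCharCores_exists_level_splits_component h37.toProp36Hypotheses v₀ hVt hEt) h37.toProp36Hypotheses.isConnected (ofCharCores_splits_self h37.toProp36Hypotheses v₀ hVt hEt) (ofCharCores_isFinite h37.toProp36Hypotheses v₀ hVt hEt) (ofCharCores_hasNonemptyFibres h37.toProp36Hypotheses v₀ hVt hEt) T R ρ' baseAct h37 hG hV hBR) (fun k : ℕ => k) (GaloisLevelData.ofCharCores_ker_piLevelAut_eq_charOpenCore h37.toProp36Hypotheses v₀ hVt hEt)).2 i.1) g).hom.branchMap (β' i) = β' i) →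
      ∃ (v : 𝒢.graph.Vertex) (b b' : 𝒢.graph.Branch) (a : PA) (h : outerSemidirectProduct ρ'),
        (decompositionDataOfChart Rc (toOuterSemidirectProduct ρ')).abut b = some v ∧ (decompositionDataOfChart Rc (toOuterSemidirectProduct ρ')).abut b' = some v ∧
        h ∈ (decompositionDataOfChart Rc (toOuterSemidirectProduct ρ')).vertGp v ∧ (b' ≠ b ∨ h ∉ (decompositionDataOfChart Rc (toOuterSemidirectProduct ρ')).brGp b) ∧
        C.map (outerSemidirectProductSnd ρ') ≤ conjSubgroup a (((decompositionDataOfChart Rc (toOuterSemidirectProduct ρ')).brGp b ⊓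
          conjSubgroup h ((decompositionDataOfChart Rc (toOuterSemidirectProduct ρ')).brGp b')).map (outerSemidirectProductSnd ρ')))
    (hest : IsTotallyArithEstranged (decompositionDataOfChart Rc (toOuterSemidirectProduct ρ')) (outerSemidirectProductSnd ρ')) (hbot : ¬ IsArithAmple (outerSemidirectProductSnd ρ') ⊥) :
    ArithMaximalCompactStatementI (decompositionDataOfChart Rc (toOuterSemidirectProduct ρ')) (outerSemidirectProductSnd ρ') ∧
      ArithMaximalCompactStatementII (decompositionDataOfChart Rc (toOuterSemidirectProduct ρ')) (outerSemidirectProductSnd ρ') :=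
  arithMaximalCompactStatement_outerAction_piPresentation_charCores_of_producers_levelTopology h37 hG v₀ hVt hEt
    ρ' baseAct T R Rc hV hE hopen hBR w₀ (fun k : ℕ => k)
    (GaloisLevelData.ofCharCores_ker_piLevelAut_eq_charOpenCore h37.toProp36Hypotheses v₀ hVt hEt)
    hK1' hinst noSwitchBase stabBranchPairAug hest hbot

end ProfiniteSemiGraph

end Literature.AnabelianGeometry.SemiGraphs
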